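import Literature.NumberTheory.EllipticCurves.ShaIsogenyProofs
import Literature.NumberTheory.EllipticCurves.IsogenyDualProofs
import HarnessLib

/-!
# `Ш(E/K)[p^∞] ≅ Ш(E'/K)[p^∞]` along an isogeny of degree prime to `p`

`Proofs` companion (theorems only; no new definition, no new named fact — D-0014/D-0026) of
`Literature.NumberTheory.EllipticCurves.ShaIsogeny` (Milne, *Arithmetic Duality Theorems*,
Lemma I.7.1(b): finiteness of `Ш` is an isogeny invariant) and `ShaIsogenyProofs`
(`Isogeny.hasLocalPointsMaps_toAddMonoidHom`: every isogeny acts on local points, so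
`Ш(φ) : Ш(E/K) → Ш(E'/K)` exists). Written for the cell `b2b-bsdr2sha` (rank-`2` certified
`Ш[p^∞]` census), PLAN §3 **H6 (class transport)**: a census row
"`#Ш(E/ℚ)[p^∞] = p^k`" proved for one curve of an isogeny class is a theorem for every curve of
the class reached from it by an isogeny of degree prime to `p` (when `ρ̄_{E,p}` is irreducible no
curve of the class admits a rational `p`-isogeny, and Cremona's isogeny matrix supplies the
prime-to-`p` degrees).

**The printed mechanism** (Milne, *ADT*, proof of Lemma I.7.1(b), p. 96: "there exists an isogeny
`g : B → A` such that `g ∘ f = deg(f)`"; Cassels, *J. reine angew. Math.* 217 (1965) for elliptic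
curves; Stein–Wuthrich, *Math. Comp.* 82 (2013), §12.3, p. 30 of the author version, use the
companion statement "isogeny invariance of the Birch and Swinnerton-Dyer conjecture" to move a
`7`-part bound between `858k1` and `858k2`): for an isogeny `φ : E → E'` of degree `n` with dual
`ψ`, `ψ ∘ φ = [n]` on `E` and `φ ∘ ψ = [n]` on `E'`, hence `Ш(ψ) ∘ Ш(φ) = n` and
`Ш(φ) ∘ Ш(ψ) = n`. If `p ∤ n`, multiplication by `n` is bijective on every `p`-primary torsion
group (Bézout: `a n + b p^k = 1`), so `Ш(φ)` restricts to an ISOMORPHISM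
`Ш(E/K)[p^∞] ≅ Ш(E'/K)[p^∞]`; in particular `#Ш(E/K)[p^∞] = #Ш(E'/K)[p^∞]` (as `Nat.card`, so
also when both are infinite) and one is finite iff the other is. No finiteness of `Ш` is assumed.
Everything used is a theorem of the tree: the dual isogeny (`Isogeny.exists_dual_of_isElliptic`,
Silverman *AEC* III.6.1(a)), surjectivity of isogenies on `K̄`-points (`Isogeny.surjective`,
*AEC* II.2.3, giving `φ ∘ ψ = [n]` from `ψ ∘ φ = [n]`), the map `Ш(φ)`
(`Literature.NumberTheory.EllipticCurves.shaMap`) and `Ш(g) ∘ Ш(f) = n`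
(`galH1Map_galH1Map_of_comp_eq_nsmul`).

## Main statements (all proved; `K` a number field, `W, W'` elliptic)

* `Isogeny.shaMap_shaMap_eq_nsmul`: `Ш(ψ) (Ш(φ) c) = deg φ • c` and
  `Isogeny.shaMap_shaMap_eq_nsmul'`: `Ш(φ) (Ш(ψ) c') = deg φ • c'` for the dual pair;
* `Isogeny.exists_addEquiv_primaryComponent_sha`: `p ∤ deg φ` ⇒
  `Ш(E/K)[p^∞] ≃+ Ш(E'/K)[p^∞]` (restriction of `Ш(φ)`);
* `Isogeny.natCard_primaryComponent_sha_eq`: `p ∤ deg φ` ⇒ `#Ш(E/K)[p^∞] = #Ш(E'/K)[p^∞]`;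
* `Isogeny.finite_primaryComponent_sha_iff_of_not_dvd`: `p ∤ deg φ` ⇒
  (`Ш(E/K)[p^∞]` finite ⟺ `Ш(E'/K)[p^∞]` finite) — by the bijection, independently of the corank
  route `finite_primaryComponent_sha_iff_of_isIsogenous` (which holds for every isogeny).

References: J. S. Milne, *Arithmetic Duality Theorems* (2nd ed. 2006), Ch. I, Lemma 7.1(b) and its
proof, p. 96 [MilneADT2006]; J. W. S. Cassels, *Arithmetic on curves of genus 1. VIII*, J. reine
angew. Math. 217 (1965) [Cassels1965ArithmeticVIII]; J. H. Silverman, *AEC*, III.6.1–6.2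
[SilvermanAEC2009]; W. Stein, C. Wuthrich, Math. Comp. 82 (2013), §12.3 [SteinWuthrich2013].
-/

set_option autoImplicit false

noncomputable section

open scoped Classical

universe u

namespace WeierstrassCurve

namespace Isogeny

open Literature.NumberTheory.EllipticCurves

variable {K : Type u} [Field K] [NumberField K] {W W' : WeierstrassCurve K}
  [W.IsElliptic] [W'.IsElliptic]

omit [NumberField K] in
/-- `φ ∘ ψ = [deg φ]` on `E'(K̄)` follows from `ψ ∘ φ = [deg φ]` on `E(K̄)` because `φ` is onto
(`Isogeny.surjective`, Silverman *AEC* II.2.3); Silverman, *AEC*, Thm. III.6.2(a).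
[cite: SilvermanAEC2009, Thm. III.6.2(a)] -/
theorem comp_dual_eq_degree_smul (φ : Isogeny W W') (ψ : Isogeny W' W)
    (hψ : ∀ P : W.geomPoints, ψ (φ P) = (φ.degree : ℤ) • P) (Q : W'.geomPoints) :
    φ (ψ Q) = (φ.degree : ℤ) • Q := by
  obtain ⟨P, rfl⟩ := φ.surjective Q
  rw [hψ, map_zsmul]

omit [W.IsElliptic] [W'.IsElliptic] in
/-- **`Ш(ψ) (Ш(φ) c) = deg φ • c`** on `Ш(E/K)` for an isogeny `φ` and an isogeny `ψ` with
`ψ ∘ φ = [deg φ]` (the dual): the identity `H¹(ψ) ∘ H¹(φ) = deg φ`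
(`galH1Map_galH1Map_of_comp_eq_nsmul`) restricted to `Ш`. Milne, *ADT*, proof of Lemma I.7.1(b).
[cite: MilneADT2006, Ch. I Lemma 7.1(b) (proof), p. 96] -/
theorem shaMap_shaMap_eq_nsmul (φ : Isogeny W W') (ψ : Isogeny W' W)
    (hψ : ∀ P : W.geomPoints, ψ (φ P) = (φ.degree : ℤ) • P) (c : W.sha) :
    shaMap ψ.toAddMonoidHom ψ.equivariant ψ.hasLocalPointsMaps_toAddMonoidHom
        (shaMap φ.toAddMonoidHom φ.equivariant φ.hasLocalPointsMaps_toAddMonoidHom c) =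
      φ.degree • c := by
  apply Subtype.ext
  rw [coe_shaMap_apply, coe_shaMap_apply, AddSubmonoidClass.coe_nsmul]
  exact galH1Map_galH1Map_of_comp_eq_nsmul φ.toAddMonoidHom φ.equivariant ψ.toAddMonoidHom
    ψ.equivariant (fun P ↦ hψ P) (c : W.galH1)

/-- **`Ш(φ) (Ш(ψ) c') = deg φ • c'`** on `Ш(E'/K)` (same, with `φ ∘ ψ = [deg φ]` from
`comp_dual_eq_degree_smul`). Milne, *ADT*, proof of Lemma I.7.1(b); Silverman III.6.2(a).
[cite: MilneADT2006, Ch. I Lemma 7.1(b) (proof), p. 96] -/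
theorem shaMap_shaMap_eq_nsmul' (φ : Isogeny W W') (ψ : Isogeny W' W)
    (hψ : ∀ P : W.geomPoints, ψ (φ P) = (φ.degree : ℤ) • P) (c' : W'.sha) :
    shaMap φ.toAddMonoidHom φ.equivariant φ.hasLocalPointsMaps_toAddMonoidHom
        (shaMap ψ.toAddMonoidHom ψ.equivariant ψ.hasLocalPointsMaps_toAddMonoidHom c') =
      φ.degree • c' := by
  apply Subtype.ext
  rw [coe_shaMap_apply, coe_shaMap_apply, AddSubmonoidClass.coe_nsmul]
  exact galH1Map_galH1Map_of_comp_eq_nsmul ψ.toAddMonoidHom ψ.equivariant φ.toAddMonoidHom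
    φ.equivariant (fun Q ↦ comp_dual_eq_degree_smul φ ψ hψ Q) (c' : W'.galH1)

/-- A homomorphism maps `p`-primary elements to `p`-primary elements (local copy of the tree's
`Literature.NumberTheory.EllipticCurves.map_mem_primaryComponent`, to keep imports light).
[folklore] -/
private theorem map_mem_primaryComponent_aux {A B : Type*} [AddCommGroup A] [AddCommGroup B]
    (f : A →+ B) {p : ℕ} {a : A} (ha : a ∈ AddCommGroup.primaryComponent A p) :
    f a ∈ AddCommGroup.primaryComponent B p := by
  obtain ⟨k, hk⟩ := AddCommGroup.mem_primaryComponent.mp ha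
  exact AddCommGroup.mem_primaryComponent.mpr ⟨k, by rw [← map_nsmul, hk, map_zero]⟩

/-- **Bézout on a `p`-primary element**: if `p ∤ n` and `p^k • x = 0` then
`x = a • (n • x)` for some integer `a` (from `a n + b p^k = 1`). [folklore] -/
private theorem exists_zsmul_nsmul_eq_of_not_dvd {A : Type*} [AddCommGroup A] {p : ℕ}
    [hp : Fact p.Prime] {n : ℕ} (hn : ¬ p ∣ n) {x : A} (hx : x ∈ AddCommGroup.primaryComponent A p) :
    ∃ a : ℤ, a • ((n : ℤ) • x) = x := by
  obtain ⟨k, hk⟩ := AddCommGroup.mem_primaryComponent.mp hx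
  have hcop : Nat.Coprime n (p ^ k) :=
    (Nat.Coprime.symm ((Nat.Prime.coprime_iff_not_dvd hp.out).mpr hn)).pow_right k
  obtain ⟨a, b, hab⟩ := Nat.isCoprime_iff_coprime.mpr hcop
  refine ⟨a, ?_⟩
  have hpk : ((p ^ k : ℕ) : ℤ) • x = 0 := by rw [natCast_zsmul, hk]
  calc a • ((n : ℤ) • x) = a • ((n : ℤ) • x) + b • (((p ^ k : ℕ) : ℤ) • x) := by
        rw [hpk, smul_zero, add_zero]
    _ = (a * (n : ℤ) + b * ((p ^ k : ℕ) : ℤ)) • x := by rw [add_smul, mul_smul, mul_smul]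
    _ = x := by rw [hab, one_smul]

/-- **`Ш(E/K)[p^∞] ≃+ Ш(E'/K)[p^∞]` along an isogeny of degree prime to `p`** (restriction of
`Ш(φ)`; inverse `a • Ш(ψ)` on an element killed by `p^k`, `a n + b p^k = 1`). Elliptic curves over
a number field `K`; no finiteness of `Ш` assumed. Mechanism of Milne, *ADT*, Lemma I.7.1(b)
(`Ш(ψ) ∘ Ш(φ) = deg φ`), refined to `p`-primary parts. [cite: MilneADT2006, Ch. I Lemma 7.1(b) (proof), p. 96] -/
theorem exists_addEquiv_primaryComponent_sha (φ : Isogeny W W') (p : ℕ) [Fact p.Prime]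
    (hp : ¬ p ∣ φ.degree) :
    ∃ e : AddCommGroup.primaryComponent W.sha p ≃+ AddCommGroup.primaryComponent W'.sha p,
      ∀ c, ((e c : W'.sha) : W'.galH1) = galH1Map φ.toAddMonoidHom φ.equivariant (c : W.sha) := by
  obtain ⟨ψ, hψ⟩ := φ.exists_dual_of_isElliptic
  set F := shaMap φ.toAddMonoidHom φ.equivariant φ.hasLocalPointsMaps_toAddMonoidHom with hF
  set G := shaMap ψ.toAddMonoidHom ψ.equivariant ψ.hasLocalPointsMaps_toAddMonoidHom with hG
  have hGF : ∀ c : W.sha, G (F c) = φ.degree • c := fun c ↦ shaMap_shaMap_eq_nsmul φ ψ hψ c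
  have hFG : ∀ c' : W'.sha, F (G c') = φ.degree • c' := fun c' ↦ shaMap_shaMap_eq_nsmul' φ ψ hψ c'
  -- the restriction of `Ш(φ)` to the `p`-primary components
  let Fp : AddCommGroup.primaryComponent W.sha p →+ AddCommGroup.primaryComponent W'.sha p :=
    (F.comp (AddCommGroup.primaryComponent W.sha p).subtype).codRestrict _
      fun c ↦ map_mem_primaryComponent_aux F c.2
  have hFp : ∀ c : AddCommGroup.primaryComponent W.sha p, (Fp c : W'.sha) = F c := fun _ ↦ rfl
  have hinj : Function.Injective Fp := by
    intro c₁ c₂ h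
    -- work with the difference
    rw [← sub_eq_zero] at h ⊢
    rw [← map_sub] at h
    set c := c₁ - c₂
    have hc0 : F (c : W.sha) = 0 := by rw [← hFp, h]; rfl
    have hn0 : (φ.degree : ℤ) • (c : W.sha) = 0 := by
      rw [natCast_zsmul, ← hGF, hc0, map_zero]
    obtain ⟨a, ha⟩ := exists_zsmul_nsmul_eq_of_not_dvd (A := W.sha) hp c.2
    apply Subtype.ext
    rw [ZeroMemClass.coe_zero, ← ha, hn0, smul_zero]
  have hsurj : Function.Surjective Fp := by
    intro c'
    obtain ⟨a, ha⟩ := exists_zsmul_nsmul_eq_of_not_dvd (A := W'.sha) hp c'.2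
    have hmem : a • G (c' : W'.sha) ∈ AddCommGroup.primaryComponent W.sha p :=
      AddSubgroup.zsmul_mem _ (map_mem_primaryComponent_aux G c'.2) a
    refine ⟨⟨a • G (c' : W'.sha), hmem⟩, Subtype.ext ?_⟩
    rw [hFp]
    change F (a • G (c' : W'.sha)) = (c' : W'.sha)
    rw [map_zsmul, hFG, ← natCast_zsmul]
    exact ha
  refine ⟨AddEquiv.ofBijective Fp ⟨hinj, hsurj⟩, fun c ↦ ?_⟩
  rw [AddEquiv.ofBijective_apply, hFp, hF, coe_shaMap_apply]

/-- **`#Ш(E/K)[p^∞] = #Ш(E'/K)[p^∞]` along an isogeny of degree prime to `p`** (as `Nat.card`;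
both sides are `0` together when infinite). Elliptic curves over a number field.
[cite: MilneADT2006, Ch. I Lemma 7.1(b) (proof), p. 96] -/
theorem natCard_primaryComponent_sha_eq (φ : Isogeny W W') (p : ℕ) [Fact p.Prime]
    (hp : ¬ p ∣ φ.degree) :
    Nat.card (AddCommGroup.primaryComponent W.sha p) =
      Nat.card (AddCommGroup.primaryComponent W'.sha p) := by
  obtain ⟨e, -⟩ := φ.exists_addEquiv_primaryComponent_sha p hp
  exact Nat.card_congr e.toEquiv

/-- **`Ш(E/K)[p^∞]` is finite iff `Ш(E'/K)[p^∞]` is, along an isogeny of degree prime to `p`**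
(by the bijection; for an arbitrary isogeny see `finite_primaryComponent_sha_iff_of_isIsogenous`).
[cite: MilneADT2006, Ch. I Lemma 7.1(b), p. 96] -/
theorem finite_primaryComponent_sha_iff_of_not_dvd (φ : Isogeny W W') (p : ℕ) [Fact p.Prime]
    (hp : ¬ p ∣ φ.degree) :
    Finite (AddCommGroup.primaryComponent W.sha p) ↔
      Finite (AddCommGroup.primaryComponent W'.sha p) := by
  obtain ⟨e, -⟩ := φ.exists_addEquiv_primaryComponent_sha p hp
  exact Equiv.finite_iff e.toEquiv

/-- **Transport of a census row**: if `#Ш(E/K)[p^∞] = p^k` and `φ : E → E'` has degree prime to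
`p`, then `#Ш(E'/K)[p^∞] = p^k` (and conversely). The form consumed by the rank-`2` census
(cell `b2b-bsdr2sha`, PLAN §3 H6). [cite: MilneADT2006, Ch. I Lemma 7.1(b) (proof), p. 96] -/
theorem natCard_primaryComponent_sha_eq_iff (φ : Isogeny W W') (p : ℕ) [Fact p.Prime]
    (hp : ¬ p ∣ φ.degree) (m : ℕ) :
    Nat.card (AddCommGroup.primaryComponent W.sha p) = m ↔
      Nat.card (AddCommGroup.primaryComponent W'.sha p) = m := by
  rw [φ.natCard_primaryComponent_sha_eq p hp]

end Isogeny

end WeierstrassCurve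

end
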